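import Mathlib
import Summits.Ventures.HodgeRepro0.CMCombinatorics

/-!
# Decidable certificate for the two degenerate simple CM fourfold classes of the census
(cell pub-hodge-repro0, seat p8; `proofs/p8-g4-census.md` §3, classes #16 and #25)

For each class we list the generators of the Galois group `G ⊂ C₂ ≀ S₄` (as permutations of
`Fin 8`, `ι = (0 4)(1 5)(2 6)(3 7)`), the CM type `Φ`, and the six `G`-translates of `Φ`; we check by
`decide` that the translates are closed under the generators (so they are the whole `G`-orbit of
`Φ`, each being an explicit image of `Φ`), that exactly the listed eight 4-subsets are Hodge sets,
that the only 2-element Hodge sets are the four `ι`-pairs, and that the two `k`-fibres are Hodge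
sets which are not `ι`-stable.  From the accepted theorem
`CMTypeData.stable_of_isHodgeSet_of_nondegenerate` it follows that the CM-type data is NOT
nondegenerate (Kubota rank < 5), and from the classification of the 2-element Hodge sets that
the `k`-fibres are not pair-decomposable (exceptional Hodge classes).
-/

namespace HodgeRepro0.CensusG4

open Finset
open Equiv (swap)
open HodgeRepro0.CMCombinatorics

/-- permutations of the 8 embeddings -/
abbrev P8 := Equiv.Perm (Fin 8)

/-- complex conjugation `ι = (0 4)(1 5)(2 6)(3 7)` -/
def ι : P8 := swap 0 4 * swap 1 5 * swap 2 6 * swap 3 7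

/-- `ι` is an involution -/
lemma ι_ι (x : Fin 8) : ι (ι x) = x := by revert x; decide
/-- `ι` has no fixed point -/
lemma ι_ne (x : Fin 8) : ι x ≠ x := by revert x; decide

/-- the two `k`-fibres are not `ι`-stable, the pairs are. -/
def pairs : Finset (Finset (Fin 8)) := {{0, 4}, {1, 5}, {2, 6}, {3, 7}}

/-- The CM-type data attached to an explicit list of translates. -/
def data (tr : Fin 6 → Finset (Fin 8)) (h : ∀ i x, x ∈ tr i ↔ ι x ∉ tr i) :
    CMTypeData (Fin 8) (Fin 6) where
  ι := ι
  ι_ι := ι_ι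
  ι_ne := ι_ne
  T := tr
  mem_T_iff := h

section Class16

/-- class #16: `G ≅ C₂ × A₄`, generators `ι`, `(0 1)(2 7)(3 6)(4 5)`, `(0 2)(1 7)(3 5)(4 6)`,
`(1 6 7)(2 3 5)` -/
def a16 : P8 := swap 0 1 * swap 2 7 * swap 3 6 * swap 4 5
/-- generator `(0 2)(1 7)(3 5)(4 6)` -/
def b16 : P8 := swap 0 2 * swap 1 7 * swap 3 5 * swap 4 6
/-- generator `(1 6 7)(2 3 5)` -/
def c16 : P8 := swap 1 6 * swap 6 7 * swap 2 3 * swap 3 5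

/-- the CM type `Φ = {0,1,2,7}` -/
def Φ16 : Finset (Fin 8) := {0, 1, 2, 7}

/-- its six Galois translates -/
def tr16 : Fin 6 → Finset (Fin 8) :=
  ![{0, 1, 2, 7}, {0, 1, 3, 6}, {0, 5, 6, 7}, {1, 2, 3, 4}, {2, 4, 5, 7}, {3, 4, 5, 6}]

/-- every translate is an `ι`-transversal -/
lemma tr16_transversal : ∀ i x, x ∈ tr16 i ↔ ι x ∉ tr16 i := by decide

/-- the generators commute with `ι` -/
lemma gens16_comm : ∀ x, a16 (ι x) = ι (a16 x) ∧ b16 (ι x) = ι (b16 x) ∧ c16 (ι x) = ι (c16 x) := by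
  decide

/-- the list of translates is stable under the generators (hence under `G`) -/
lemma tr16_closed :
    ∀ i, ∃ j, (tr16 i).map a16.toEmbedding = tr16 j ∧
      ∃ j', (tr16 i).map b16.toEmbedding = tr16 j' ∧
      ∃ j'', (tr16 i).map c16.toEmbedding = tr16 j'' ∧
      ∃ j''', (tr16 i).map ι.toEmbedding = tr16 j''' := by decide

/-- each listed translate is an explicit image of `Φ` -/
lemma tr16_reached :
    tr16 0 = Φ16 ∧ tr16 1 = Φ16.map c16.toEmbedding ∧ tr16 2 = Φ16.map (c16 * c16).toEmbedding ∧
    tr16 3 = Φ16.map (c16 * c16 * ι).toEmbedding ∧ tr16 4 = Φ16.map (c16 * ι).toEmbedding ∧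
    tr16 5 = Φ16.map ι.toEmbedding := by decide

/-- the CM-type data of class #16 -/
def D16 : CMTypeData (Fin 8) (Fin 6) := data tr16 tr16_transversal

/-- the Hodge 4-sets are exactly these eight -/
lemma hodge4_16 :
    (Finset.univ.powersetCard 4).filter (fun S => ∀ i, 2 * (S ∩ tr16 i).card = S.card) =
      {{0, 1, 4, 5}, {0, 2, 3, 5}, {0, 2, 4, 6}, {0, 3, 4, 7}, {1, 2, 5, 6}, {1, 3, 5, 7},
        {1, 4, 6, 7}, {2, 3, 6, 7}} := by decide

/-- the 2-element Hodge sets are exactly the four `ι`-pairs -/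
lemma hodge2_16 :
    (Finset.univ.powersetCard 2).filter (fun S => ∀ i, 2 * (S ∩ tr16 i).card = S.card) = pairs := by
  decide

/-- the `k`-fibre `{0,2,3,5}` is a Hodge set … -/
lemma fibre16_isHodgeSet : D16.IsHodgeSet {0, 2, 3, 5} := by
  intro i; revert i; decide

/-- … which is not `ι`-stable -/
lemma fibre16_not_stable : ¬ ∀ x, x ∈ ({0, 2, 3, 5} : Finset (Fin 8)) ↔ D16.ι x ∈ ({0, 2, 3, 5} : Finset (Fin 8)) := by
  decide

/-- **class #16 is degenerate**: the data is not nondegenerate in the sense of `CMTypeData`. -/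
theorem class16_not_nondegenerate : ¬ D16.Nondegenerate := fun hD =>
  fibre16_not_stable (D16.stable_of_isHodgeSet_of_nondegenerate hD fibre16_isHodgeSet)

/-- **class #16 has an exceptional Hodge set**: `{0,2,3,5}` is a Hodge set that is not
pair-decomposable. -/
theorem class16_exceptional : D16.IsHodgeSet {0, 2, 3, 5} ∧ ¬ D16.PairDecomposable {0, 2, 3, 5} := by
  refine ⟨fibre16_isHodgeSet, ?_⟩
  rintro ⟨P, hP, -, hU⟩
  -- every member of `P` is a 2-element Hodge set, hence an `ι`-pair; so the union is `ι`-stable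
  have hpair : ∀ Q ∈ P, Q ∈ pairs := by
    intro Q hQ
    obtain ⟨h2, hH⟩ := hP Q hQ
    have : Q ∈ (Finset.univ.powersetCard 2).filter
        (fun S => ∀ i, 2 * (S ∩ tr16 i).card = S.card) := by
      rw [Finset.mem_filter, Finset.mem_powersetCard]
      exact ⟨⟨Finset.subset_univ _, h2⟩, hH⟩
    rwa [hodge2_16] at this
  have hstable : ∀ x, x ∈ P.biUnion id ↔ ι x ∈ P.biUnion id := by
    intro x
    simp only [Finset.mem_biUnion, id]
    constructor
    · rintro ⟨Q, hQ, hx⟩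
      refine ⟨Q, hQ, ?_⟩
      have := hpair Q hQ
      simp only [pairs, Finset.mem_insert, Finset.mem_singleton] at this
      rcases this with rfl | rfl | rfl | rfl <;> revert x <;> decide
    · rintro ⟨Q, hQ, hx⟩
      refine ⟨Q, hQ, ?_⟩
      have := hpair Q hQ
      simp only [pairs, Finset.mem_insert, Finset.mem_singleton] at this
      rcases this with rfl | rfl | rfl | rfl <;> revert x <;> decide
  rw [hU] at hstable
  exact fibre16_not_stable hstable

end Class16

section Class25

/-- class #25: `G ≅ C₂ × S₄`, generators `ι`, `(2 7)(3 6)`, `(1 2)(5 6)`, `(0 1)(4 5)` -/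
def a25 : P8 := swap 2 7 * swap 3 6
/-- generator `(1 2)(5 6)` -/
def b25 : P8 := swap 1 2 * swap 5 6
/-- generator `(0 1)(4 5)` -/
def c25 : P8 := swap 0 1 * swap 4 5

/-- the CM type `Φ = {0,1,3,6}` -/
def Φ25 : Finset (Fin 8) := {0, 1, 3, 6}

/-- its six Galois translates -/
def tr25 : Fin 6 → Finset (Fin 8) :=
  ![{0, 1, 3, 6}, {0, 2, 3, 5}, {0, 5, 6, 7}, {1, 2, 3, 4}, {1, 4, 6, 7}, {2, 4, 5, 7}]

/-- every translate is an `ι`-transversal -/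
lemma tr25_transversal : ∀ i x, x ∈ tr25 i ↔ ι x ∉ tr25 i := by decide

/-- the generators commute with `ι` -/
lemma gens25_comm : ∀ x, a25 (ι x) = ι (a25 x) ∧ b25 (ι x) = ι (b25 x) ∧ c25 (ι x) = ι (c25 x) := by
  decide

/-- the list of translates is stable under the generators (hence under `G`) -/
lemma tr25_closed :
    ∀ i, ∃ j, (tr25 i).map a25.toEmbedding = tr25 j ∧
      ∃ j', (tr25 i).map b25.toEmbedding = tr25 j' ∧
      ∃ j'', (tr25 i).map c25.toEmbedding = tr25 j'' ∧
      ∃ j''', (tr25 i).map ι.toEmbedding = tr25 j''' := by decide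

/-- each listed translate is an explicit image of `Φ` -/
lemma tr25_reached :
    tr25 0 = Φ25 ∧ tr25 1 = Φ25.map b25.toEmbedding ∧ tr25 2 = Φ25.map (a25 * b25).toEmbedding ∧
    tr25 3 = Φ25.map (c25 * b25).toEmbedding ∧ tr25 4 = Φ25.map (b25 * ι).toEmbedding ∧
    tr25 5 = Φ25.map ι.toEmbedding := by decide

/-- the CM-type data of class #25 -/
def D25 : CMTypeData (Fin 8) (Fin 6) := data tr25 tr25_transversal

/-- the Hodge 4-sets are exactly these eight -/
lemma hodge4_25 :
    (Finset.univ.powersetCard 4).filter (fun S => ∀ i, 2 * (S ∩ tr25 i).card = S.card) =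
      {{0, 1, 2, 7}, {0, 1, 4, 5}, {0, 2, 4, 6}, {0, 3, 4, 7}, {1, 2, 5, 6}, {1, 3, 5, 7},
        {2, 3, 6, 7}, {3, 4, 5, 6}} := by decide

/-- the 2-element Hodge sets are exactly the four `ι`-pairs -/
lemma hodge2_25 :
    (Finset.univ.powersetCard 2).filter (fun S => ∀ i, 2 * (S ∩ tr25 i).card = S.card) = pairs := by
  decide

/-- the `k`-fibre `{0,1,2,7}` is a Hodge set … -/
lemma fibre25_isHodgeSet : D25.IsHodgeSet {0, 1, 2, 7} := by
  intro i; revert i; decide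

/-- … which is not `ι`-stable -/
lemma fibre25_not_stable : ¬ ∀ x, x ∈ ({0, 1, 2, 7} : Finset (Fin 8)) ↔ D25.ι x ∈ ({0, 1, 2, 7} : Finset (Fin 8)) := by
  decide

/-- **class #25 is degenerate** -/
theorem class25_not_nondegenerate : ¬ D25.Nondegenerate := fun hD =>
  fibre25_not_stable (D25.stable_of_isHodgeSet_of_nondegenerate hD fibre25_isHodgeSet)

/-- **class #25 has an exceptional Hodge set** `{0,1,2,7}` -/
theorem class25_exceptional : D25.IsHodgeSet {0, 1, 2, 7} ∧ ¬ D25.PairDecomposable {0, 1, 2, 7} := by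
  refine ⟨fibre25_isHodgeSet, ?_⟩
  rintro ⟨P, hP, -, hU⟩
  have hpair : ∀ Q ∈ P, Q ∈ pairs := by
    intro Q hQ
    obtain ⟨h2, hH⟩ := hP Q hQ
    have : Q ∈ (Finset.univ.powersetCard 2).filter
        (fun S => ∀ i, 2 * (S ∩ tr25 i).card = S.card) := by
      rw [Finset.mem_filter, Finset.mem_powersetCard]
      exact ⟨⟨Finset.subset_univ _, h2⟩, hH⟩
    rwa [hodge2_25] at this
  have hstable : ∀ x, x ∈ P.biUnion id ↔ ι x ∈ P.biUnion id := by
    intro x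
    simp only [Finset.mem_biUnion, id]
    constructor
    · rintro ⟨Q, hQ, hx⟩
      refine ⟨Q, hQ, ?_⟩
      have := hpair Q hQ
      simp only [pairs, Finset.mem_insert, Finset.mem_singleton] at this
      rcases this with rfl | rfl | rfl | rfl <;> revert x <;> decide
    · rintro ⟨Q, hQ, hx⟩
      refine ⟨Q, hQ, ?_⟩
      have := hpair Q hQ
      simp only [pairs, Finset.mem_insert, Finset.mem_singleton] at this
      rcases this with rfl | rfl | rfl | rfl <;> revert x <;> decide
  rw [hU] at hstable
  exact fibre25_not_stable hstable

end Class25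

section Orbit16

/-- the Galois group of class #16 as the subgroup generated by the listed generators -/
def G16 : Subgroup P8 := Subgroup.closure {ι, a16, b16, c16}

/-- `tr16` is injective (the six translates are distinct) -/
lemma tr16_injective : Function.Injective tr16 := by decide

/-- composing with `x⁻¹` undoes `map x` -/
lemma map_map_symm (x : P8) (S : Finset (Fin 8)) :
    (S.map x.toEmbedding).map x.symm.toEmbedding = S := by
  ext y
  simp only [Finset.mem_map, Equiv.toEmbedding_apply]
  constructor
  · rintro ⟨z, ⟨w, hw, rfl⟩, rfl⟩
    simpa using hw
  · intro hy
    exact ⟨x y, ⟨y, hy, rfl⟩, by simp⟩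

/-- `map 1` is the identity -/
lemma map_one_perm (S : Finset (Fin 8)) : S.map (1 : P8).toEmbedding = S := by
  ext y
  simp only [Finset.mem_map, Equiv.toEmbedding_apply, Equiv.Perm.coe_one, id_eq, exists_eq_right]

/-- every element of `G16` permutes the list of translates -/
lemma G16_maps_tr16 : ∀ g ∈ G16, ∀ i, ∃ j, (tr16 i).map g.toEmbedding = tr16 j := by
  intro g hg
  induction hg using Subgroup.closure_induction with
  | mem x hx =>
    simp only [Set.mem_insert_iff, Set.mem_singleton_iff] at hx
    intro i
    obtain ⟨j, hj, j', hj', j'', hj'', j3, hj3⟩ := tr16_closed i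
    rcases hx with rfl | rfl | rfl | rfl
    · exact ⟨j3, hj3⟩
    · exact ⟨j, hj⟩
    · exact ⟨j', hj'⟩
    · exact ⟨j'', hj''⟩
  | one => intro i; exact ⟨i, map_one_perm _⟩
  | mul x y _ _ hx hy =>
    intro i
    obtain ⟨j, hj⟩ := hy i
    obtain ⟨k, hk⟩ := hx j
    refine ⟨k, ?_⟩
    rw [← hk, ← hj, Finset.map_map]
    rfl
  | inv x _ hx =>
    choose f hf using hx
    have hinj : Function.Injective f := by
      intro i i' h
      apply tr16_injective
      rw [← map_map_symm x (tr16 i), ← map_map_symm x (tr16 i'), hf i, hf i', h]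
    have hsurj : Function.Surjective f := Finite.injective_iff_surjective.mp hinj
    intro j
    obtain ⟨i, hi⟩ := hsurj j
    refine ⟨i, ?_⟩
    rw [← hi, ← hf i]
    exact map_map_symm x (tr16 i)

/-- **the listed translates are exactly the `G16`-orbit of `Φ16`** -/
theorem tr16_orbit : {S | ∃ g ∈ G16, S = Φ16.map g.toEmbedding} = {S | ∃ i, S = tr16 i} := by
  ext S
  constructor
  · rintro ⟨g, hg, rfl⟩
    obtain ⟨j, hj⟩ := G16_maps_tr16 g hg 0
    exact ⟨j, by rw [← hj]; rfl⟩
  · rintro ⟨i, rfl⟩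
    have hι : ι ∈ G16 := Subgroup.subset_closure (by simp)
    have ha : a16 ∈ G16 := Subgroup.subset_closure (by simp)
    have hb : b16 ∈ G16 := Subgroup.subset_closure (by simp)
    have hc : c16 ∈ G16 := Subgroup.subset_closure (by simp)
    obtain ⟨h0, h1, h2, h3, h4, h5⟩ := tr16_reached
    fin_cases i
    · exact ⟨1, G16.one_mem, by rw [map_one_perm]; exact h0⟩
    · exact ⟨c16, hc, h1⟩
    · exact ⟨c16 * c16, G16.mul_mem hc hc, h2⟩
    · exact ⟨c16 * c16 * ι, G16.mul_mem (G16.mul_mem hc hc) hι, h3⟩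
    · exact ⟨c16 * ι, G16.mul_mem hc hι, h4⟩
    · exact ⟨ι, hι, h5⟩

end Orbit16

section Orbit25

/-- the Galois group of class #25 as the subgroup generated by the listed generators -/
def G25 : Subgroup P8 := Subgroup.closure {ι, a25, b25, c25}

/-- `tr25` is injective (the six translates are distinct) -/
lemma tr25_injective : Function.Injective tr25 := by decide

/-- every element of `G25` permutes the list of translates -/
lemma G25_maps_tr25 : ∀ g ∈ G25, ∀ i, ∃ j, (tr25 i).map g.toEmbedding = tr25 j := by
  intro g hg
  induction hg using Subgroup.closure_induction with
  | mem x hx =>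
    simp only [Set.mem_insert_iff, Set.mem_singleton_iff] at hx
    intro i
    obtain ⟨j, hj, j', hj', j'', hj'', j3, hj3⟩ := tr25_closed i
    rcases hx with rfl | rfl | rfl | rfl
    · exact ⟨j3, hj3⟩
    · exact ⟨j, hj⟩
    · exact ⟨j', hj'⟩
    · exact ⟨j'', hj''⟩
  | one => intro i; exact ⟨i, map_one_perm _⟩
  | mul x y _ _ hx hy =>
    intro i
    obtain ⟨j, hj⟩ := hy i
    obtain ⟨k, hk⟩ := hx j
    refine ⟨k, ?_⟩
    rw [← hk, ← hj, Finset.map_map]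
    rfl
  | inv x _ hx =>
    choose f hf using hx
    have hinj : Function.Injective f := by
      intro i i' h
      apply tr25_injective
      rw [← map_map_symm x (tr25 i), ← map_map_symm x (tr25 i'), hf i, hf i', h]
    have hsurj : Function.Surjective f := Finite.injective_iff_surjective.mp hinj
    intro j
    obtain ⟨i, hi⟩ := hsurj j
    refine ⟨i, ?_⟩
    rw [← hi, ← hf i]
    exact map_map_symm x (tr25 i)

/-- **the listed translates are exactly the `G25`-orbit of `Φ25`** -/
theorem tr25_orbit : {S | ∃ g ∈ G25, S = Φ25.map g.toEmbedding} = {S | ∃ i, S = tr25 i} := by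
  ext S
  constructor
  · rintro ⟨g, hg, rfl⟩
    obtain ⟨j, hj⟩ := G25_maps_tr25 g hg 0
    exact ⟨j, by rw [← hj]; rfl⟩
  · rintro ⟨i, rfl⟩
    have hι : ι ∈ G25 := Subgroup.subset_closure (by simp)
    have ha : a25 ∈ G25 := Subgroup.subset_closure (by simp)
    have hb : b25 ∈ G25 := Subgroup.subset_closure (by simp)
    have hc : c25 ∈ G25 := Subgroup.subset_closure (by simp)
    obtain ⟨h0, h1, h2, h3, h4, h5⟩ := tr25_reached
    fin_cases i
    · exact ⟨1, G25.one_mem, by rw [map_one_perm]; exact h0⟩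
    · exact ⟨b25, hb, h1⟩
    · exact ⟨a25 * b25, G25.mul_mem ha hb, h2⟩
    · exact ⟨c25 * b25, G25.mul_mem hc hb, h3⟩
    · exact ⟨b25 * ι, G25.mul_mem hb hι, h4⟩
    · exact ⟨ι, hι, h5⟩

end Orbit25

end HodgeRepro0.CensusG4
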